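import Summits.BirchSwinnertonDyer.BirchSwinnertonDyer.Theorems.ErratumRoadFiveShimuraKolyvaginOrderBoundInertMachineEntry
import Literature.NumberTheory.EllipticCurves.HeegnerPointsKolyvaginPrimaryAnnihilatorLeavesProofs
import HarnessLib

/-!
# Kolyvagin's ORDER bound for Heegner-type Euler systems, keyed on the CONDUCTOR — part 3: the duality
# leaves (B₂), (B) of the descent in order form, from Kolyvagin reciprocity in pairing form

Cell `bsd-stepL` (run/shared/lean/pub/bsd-stepL/), seat `bsd-stepL-shim3a` (prover g2), HELPER for the crux
`Summit.BirchSwinnertonDyer.BirchSwinnertonDyer.Theses.ClassRecordThree.ShimuraKolyvaginOrderBoundAtThreeSurj`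
(item stmt-BirchSwinnertonDyer-19899; `--supports … --as helper`); serves S2 of item 19718 and item 19627 too.
Road memo HOME/shim/SHIM3A-G2-ROAD-19899.md §2 (ε₃). Companions: `…SurjOrderCTValue.lean`,
`…SurjOrderReciprocity.lean`.

## What

x11b3's duality leaves of the mod-`p^M` descent in order form, `KolyvaginDescent.hdual₂_of_kolyvaginReciprocityFinset`
(two places, McCallum 1991 Lemma 5.3 with Prop. 2.2 over `λ, λ'`) and `…hdual_of_kolyvaginReciprocityFinset`
(one place), are keyed on `hP : IsHeegnerPoint N W K P`, used ONCE, for good reduction at `λ`. Conductor-keyed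
twins (statements = the tree's with `hP ↦ hN : W.conductorNorm ℤ = N`; proofs = the tree's with shim-p1's
`hasGoodReductionAt_place_of_isKolyvaginPrime_of_conductorNorm` ∕ `hdual_of_kolyvaginReciprocityM_of_conductorNorm`):

* `hdual₂_of_kolyvaginReciprocityFinset_of_conductorNorm`, `hdual_of_kolyvaginReciprocityFinset_of_conductorNorm`.

## Honest framing

THEOREMS ONLY (no `def`, no named fact, no `sorry`; axioms standard). Nothing here constructs an Euler system;
item 19899 stays OPEN. BSD is not proved by any of this.

## References

[cite: McCallumLMS1991, §2 Prop. 2.2, §5 Lemma 5.3 and proof of Prop. 5.2] [cite: GrossLMS1991, Prop. 8.2]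
presearch: not applicable (re-keying of tree theorems). Tree: `lean search 'hdual_of_kolyvaginReciprocityFinset_of_conductorNorm'` → none.
-/

noncomputable section

open scoped Classical
set_option linter.dupNamespace false
namespace Summit.BirchSwinnertonDyer.BirchSwinnertonDyer.Theorems.ShimuraKolyvaginOrder

open WeierstrassCurve NumberField IsDedekindDomain
  Literature.NumberTheory.EllipticCurves Literature.NumberTheory.EllipticCurves.KolyvaginDescent
  Literature.NumberTheory.GaloisRepresentations
  Summit.BirchSwinnertonDyer.BirchSwinnertonDyer.Theorems

variable {K : Type} [Field K] [NumberField K]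

/-! ### §2 The duality leaves (B₂), (B) of the descent in order form, conductor-keyed -/

variable (W : WeierstrassCurve ℚ)

/-- **Leaf (B₂): two-place duality in order form from Kolyvagin reciprocity, conductor-keyed** — twin of
the tree's `KolyvaginDescent.hdual₂_of_kolyvaginReciprocityFinset` (McCallum 1991 Lemma 5.3 with Prop. 2.2
over the places `λ, λ'`; tree `lemma_5_3_descent_of_reciprocity` with `T = {λ'}`) with the Heegner-point
binder replaced by `hN : W.conductorNorm ℤ = N` (its only use: good reduction at `λ`).
[cite: McCallumLMS1991, §5 Lemma 5.3, §2 Prop. 2.2, proof of Prop. 5.2] -/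
theorem hdual₂_of_kolyvaginReciprocityFinset_of_conductorNorm {N : ℕ} [NeZero N] [W.IsElliptic]
    (hN : W.conductorNorm ℤ = N) (hK : IsImaginaryQuadratic K) {p : ℕ} (hp : p.Prime) (hp2 : p ≠ 2) {M : ℕ} (hM : 1 ≤ M)
    {c : K ≃ₐ[ℚ] K} (hc : c ≠ 1)
    (hRT : ∀ {ℓ : ℕ} (hℓ : IsKolyvaginPrime N W K p ℓ), FrobEqFrobInfty W K (p ^ M) ℓ →
      ∃ (A : Type) (_ : AddCommGroup A)
        (e : geomTorsion (W.baseChange K) ((p ^ M : ℕ) : ℤ) →+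
          geomTorsion (W.baseChange K) ((p ^ M : ℕ) : ℤ) →+ A),
        (∀ x, e x x = 0) ∧ (∀ x, (∀ y, e x y = 0) → x = 0) ∧
        ∀ (T : Finset (HeightOneSpectrum (𝓞 K))),
        ∀ s ∈ selmerGroup (W.baseChange K) ((p ^ M : ℕ) : ℤ),
          (∀ v ∈ T, s ∈ (W.baseChange K).torsionLocalKer (v.adicCompletion K) ((p ^ M : ℕ) : ℤ)) →
          ∀ c' : galH1Torsion (W.baseChange K) ((p ^ M : ℕ) : ℤ),
          (∀ v : HeightOneSpectrum (𝓞 K), v ∉ T → (ℓ : 𝓞 K) ∉ v.asIdeal →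
            c' ∈ selmerLocalKer (W.baseChange K) (v.adicCompletion K) ((p ^ M : ℕ) : ℤ)) →
          (∀ w : InfinitePlace K,
            c' ∈ selmerLocalKer (W.baseChange K) w.Completion ((p ^ M : ℕ) : ℤ)) →
          ∀ 𝔔 ∈ hℓ.place.primesAbove, ∀ F : Field.absoluteGaloisGroup K,
            IsArithFrobAt (𝓞 K) F 𝔔 →
            F ∈ torsionFixing (W.baseChange K) ((p ^ M : ℕ) : ℤ) →
            ∀ σ ∈ 𝔔.inertia (Field.absoluteGaloisGroup K),
            e (h1Eval (W.baseChange K) ((p ^ M : ℕ) : ℤ) s F)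
              (h1Eval (W.baseChange K) ((p ^ M : ℕ) : ℤ) c' σ) = 0) :
    ∀ ℓ ℓ' : ℕ, IsKolyvaginPrime N W K p ℓ ∧ FrobEqFrobInfty W K (p ^ M) ℓ →
      IsKolyvaginPrime N W K p ℓ' ∧ FrobEqFrobInfty W K (p ^ M) ℓ' → ℓ ≠ ℓ' →
      ∀ ν : ℤ, (ν = 1 ∨ ν = -1) → ∀ d : galH1Torsion (W.baseChange K) ((p ^ M : ℕ) : ℤ),
      conjAct W c _ d = ν • d →
      (∀ v : HeightOneSpectrum (𝓞 K), (ℓ : 𝓞 K) ∉ v.asIdeal → (ℓ' : 𝓞 K) ∉ v.asIdeal →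
        d ∈ selmerLocalKer (W.baseChange K) (v.adicCompletion K) ((p ^ M : ℕ) : ℤ)) →
      (∀ w : InfinitePlace K,
        d ∈ selmerLocalKer (W.baseChange K) w.Completion ((p ^ M : ℕ) : ℤ)) →
      ∀ s ∈ selmerGroup (W.baseChange K) ((p ^ M : ℕ) : ℤ), conjAct W c _ s = ν • s →
      (∀ v : HeightOneSpectrum (𝓞 K), (ℓ' : 𝓞 K) ∈ v.asIdeal →
        s ∈ (W.baseChange K).torsionLocalKer (v.adicCompletion K) ((p ^ M : ℕ) : ℤ)) →
      ∀ a : ℕ, a < M → ∀ v : HeightOneSpectrum (𝓞 K), (ℓ : 𝓞 K) ∈ v.asIdeal →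
        ((p : ℤ) ^ a) • d ∉
          selmerLocalKer (W.baseChange K) (v.adicCompletion K) ((p ^ M : ℕ) : ℤ) →
        ((p : ℤ) ^ (M - 1 - a)) • s ∈
          (W.baseChange K).torsionLocalKer (v.adicCompletion K) ((p ^ M : ℕ) : ℤ) := by
  intro ℓ ℓ' hℓ hℓ' _ ν hν d hd hfin hinf s hs hτs hsℓ' a _ v hv hdv
  have hvw : v = hℓ.1.place := hℓ.1.mem_iff.mp hv
  subst hvw
  have hgood : (W.baseChange K).HasGoodReductionAt hℓ.1.place :=
    hasGoodReductionAt_place_of_isKolyvaginPrime_of_conductorNorm W hN hℓ.1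
  obtain ⟨A, _, e, halt, hnd, hRe⟩ := hRT hℓ.1 hℓ.2
  refine lemma_5_3_descent_of_reciprocity W hK hp hp2 hc hℓ.1 hM rfl hℓ.2 hgood e halt hnd hν hd
    hdv hs hτs (fun 𝔔 h𝔔 F hF hFT σ hσ ↦ hRe {hℓ'.1.place} s hs ?_ d ?_ hinf 𝔔 h𝔔 F hF hFT σ hσ)
  · intro v' hv'
    rw [Finset.mem_singleton] at hv'
    subst hv'
    exact hsℓ' _ hℓ'.1.mem_place
  · intro v' hv'T hv'ℓ
    refine hfin v' hv'ℓ (fun h ↦ hv'T ?_)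
    rw [Finset.mem_singleton, hℓ'.1.mem_iff.mp h]

/-- **Leaf (B) in order form from the same pairing-form reciprocity (`T = ∅`), conductor-keyed** — twin
of the tree's `hdual_of_kolyvaginReciprocityFinset`, through shim-p1's
`hdual_of_kolyvaginReciprocityM_of_conductorNorm`. [cite: McCallumLMS1991, §5 Lemma 5.3, §2 Prop. 2.2] -/
theorem hdual_of_kolyvaginReciprocityFinset_of_conductorNorm {N : ℕ} [NeZero N] [W.IsElliptic]
    (hN : W.conductorNorm ℤ = N) (hK : IsImaginaryQuadratic K) {p : ℕ} (hp : p.Prime) (hp2 : p ≠ 2) {M : ℕ} (hM : 1 ≤ M)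
    {c : K ≃ₐ[ℚ] K} (hc : c ≠ 1)
    (hRT : ∀ {ℓ : ℕ} (hℓ : IsKolyvaginPrime N W K p ℓ), FrobEqFrobInfty W K (p ^ M) ℓ →
      ∃ (A : Type) (_ : AddCommGroup A)
        (e : geomTorsion (W.baseChange K) ((p ^ M : ℕ) : ℤ) →+
          geomTorsion (W.baseChange K) ((p ^ M : ℕ) : ℤ) →+ A),
        (∀ x, e x x = 0) ∧ (∀ x, (∀ y, e x y = 0) → x = 0) ∧
        ∀ (T : Finset (HeightOneSpectrum (𝓞 K))),
        ∀ s ∈ selmerGroup (W.baseChange K) ((p ^ M : ℕ) : ℤ),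
          (∀ v ∈ T, s ∈ (W.baseChange K).torsionLocalKer (v.adicCompletion K) ((p ^ M : ℕ) : ℤ)) →
          ∀ c' : galH1Torsion (W.baseChange K) ((p ^ M : ℕ) : ℤ),
          (∀ v : HeightOneSpectrum (𝓞 K), v ∉ T → (ℓ : 𝓞 K) ∉ v.asIdeal →
            c' ∈ selmerLocalKer (W.baseChange K) (v.adicCompletion K) ((p ^ M : ℕ) : ℤ)) →
          (∀ w : InfinitePlace K,
            c' ∈ selmerLocalKer (W.baseChange K) w.Completion ((p ^ M : ℕ) : ℤ)) →
          ∀ 𝔔 ∈ hℓ.place.primesAbove, ∀ F : Field.absoluteGaloisGroup K,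
            IsArithFrobAt (𝓞 K) F 𝔔 →
            F ∈ torsionFixing (W.baseChange K) ((p ^ M : ℕ) : ℤ) →
            ∀ σ ∈ 𝔔.inertia (Field.absoluteGaloisGroup K),
            e (h1Eval (W.baseChange K) ((p ^ M : ℕ) : ℤ) s F)
              (h1Eval (W.baseChange K) ((p ^ M : ℕ) : ℤ) c' σ) = 0) :
    ∀ ℓ : ℕ, IsKolyvaginPrime N W K p ℓ ∧ FrobEqFrobInfty W K (p ^ M) ℓ →
      ∀ ν : ℤ, (ν = 1 ∨ ν = -1) → ∀ d : galH1Torsion (W.baseChange K) ((p ^ M : ℕ) : ℤ),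
      conjAct W c _ d = ν • d →
      (∀ v : HeightOneSpectrum (𝓞 K), (ℓ : 𝓞 K) ∉ v.asIdeal →
        d ∈ selmerLocalKer (W.baseChange K) (v.adicCompletion K) ((p ^ M : ℕ) : ℤ)) →
      (∀ w : InfinitePlace K,
        d ∈ selmerLocalKer (W.baseChange K) w.Completion ((p ^ M : ℕ) : ℤ)) →
      ∀ s ∈ selmerGroup (W.baseChange K) ((p ^ M : ℕ) : ℤ), conjAct W c _ s = ν • s →
      ∀ a : ℕ, a < M → ∀ v : HeightOneSpectrum (𝓞 K), (ℓ : 𝓞 K) ∈ v.asIdeal →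
        ((p : ℤ) ^ a) • d ∉
          selmerLocalKer (W.baseChange K) (v.adicCompletion K) ((p ^ M : ℕ) : ℤ) →
        ((p : ℤ) ^ (M - 1 - a)) • s ∈
          (W.baseChange K).torsionLocalKer (v.adicCompletion K) ((p ^ M : ℕ) : ℤ) :=
  hdual_of_kolyvaginReciprocityM_of_conductorNorm W hN hK hp hp2 hM hc fun hℓ hℓM ↦ by
    obtain ⟨A, _, e, halt, hnd, hRe⟩ := hRT hℓ hℓM
    exact ⟨A, inferInstance, e, halt, hnd, fun s hs c' hfin hinf ↦
      hRe ∅ s hs (fun _ h ↦ absurd h (Finset.notMem_empty _)) c' (fun v _ hv ↦ hfin v hv) hinf⟩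

end Summit.BirchSwinnertonDyer.BirchSwinnertonDyer.Theorems.ShimuraKolyvaginOrder
end
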